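import Summits.QuantumFields.YangMills.Theorems.BalabanUVNodesN16AtRRec12ConstLayer
import Literature.MathematicalPhysics.QuantumFieldTheory.Balaban1983to89.Node00.RateRecord11NE3Data
import HarnessLib

/-!
# Route «BalabanUVNodes», cluster K4 «SpineRates» — node N16 = NE3 AT THE STAGE-12 HOME FOR THE NE3 OBJECT OF RECORD: a rate reading whose NE3 component is
# node00-def-RR-1's CONSTANT LAYER OF RECORD `Node00.ne3ConstLayerOfRecord₁₁ F N (ℓ F)` (period `2·L^m`, `dom` = all `2·L^m`-periodic `SU(N)` unit-lattice data,
# letters `ℓ F` THE END's — `Node00/RateRecord11NE3Data.lean`, p467746) has `S_N16 (RRec₁₂ 𝔯)` IFF `N16At` holds at that ONE object for every family carrying a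
# Stage-12 datum of record; at THE END's canonical letters the proviso is automatic and the stub follows from `LeafSlot` ∕ `PrintSlot` there ALONE

Cell `pub-ymgap`, seat `pub-ymgap-dag-n16-e` (R134 acceleration seat (a), strategy s2 = BY-NAME KNIT at the record; HUMAN RULING D-0062; chair R424 venue),
generation 2, file 11 (THEOREMS ONLY, 0 `def`, 0 `sorry`).  `bears_on: R4∕N16 · K3′ SpineGivenEndpointR12 (stmt-QuantumFields-19908)`.  Filed `--supports
stmt-QuantumFields-19908 --as helper`.  Imports this seat's file 9 `BalabanUVNodesN16AtRRec12ConstLayer` (p467313) and RR-1 g4's `Node00/RateRecord11NE3Data.lean` (p467746: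
`ne3ConstLayerOfRecord₁₁`, `ne3NperOfRecord₁₁`, `ne3DomOfRecord₁₁`, `one_le_ne3NperOfRecord₁₁`).  Restates nothing; cites by name.

WHY (pub-ymgap INBOX l.13602 ∕ l.13645 ∕ dag-lead DEDUP-198, 2026-08-26).  The NE3 PIN of record is now a tree object: RR-1's constant layer
`ne3ConstLayerOfRecord₁₁ F N ℓ = NE3Objects₁₁.ofRecord F N 0 0 ℓ = ⟨2·L^m, ℓ.ε, ℓ.b, ℓ.g, ℓ.C, ℓ.Λ₁, ℓ.Λ₂', ne3DomOfRecord₁₁ F N 0 0⟩` (its reading `ne3ConstReadingOfRecord₁₁ F N ℓ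
:= fun _ ↦ …`, so a reading of record satisfies this file's `hpin` by `rfl`).  THIS FILE is the N16 home AT THAT OBJECT — the last reading-side knot: after it, what N16 owes
at the record is the CONTENT `LeafSlot` (N05's leaf t4 ∧ p3 on the univ sub-family ∘ N07's `LeafH3sup`) at ONE bundle per family, and the choice of letters `ℓ F`
inside `InEndRegime` (free; the canonical letters discharge it — §2).

v1.1 (generation 3, 2026-08-26T22:10Z; pub-ymgap INBOX l.14093, dag-n21-d g3 INTENT-2).  N21's road I at this object needs, besides THE END's proviso, the regularity
numeral `512·5·8·L²·b ≤ 1`, so it TUNES the regularity letter inside THE END's tolerance `0 ≤ b ≤ ε∕2` (its `b⋆ := min (r∕2) (1∕(512·5·8·L²))`, hosted in N21's own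
`…N21EndLettersDefs` — NOT re-declared here); N19's budget reads the constant `C` against `constOfRecord`.  §2 pinned `b = r∕2`, `C = Cof`; §3 frees both, so a
letter-tuner applies ONE theorem of this file instead of re-proving the proviso.

CONTENT.
§1 `s_N16_rRec₁₂_iff_ofRecord` (`S_N16 (RRec₁₂ 𝔯) ↔ ∀ F, (∃ D, IsDatumOfRecord₁₂C F N D) → N16At (ne3OfRecord₁₁ F (ne3ConstLayerOfRecord₁₁ F N (ℓ F)))`),
   `n16At_ofRecord_of_s_N16_rRec₁₂` (n21-d's `h16` binder at the object of record), `s_N16_rRec₁₂_ofRecord_of_printSlot` ∕ `_of_leafSlot`.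
§2 `inEndRegime_ofRecord_canonical` (the proviso AT THE OBJECT OF RECORD with THE END's canonical letters `⟨r, r∕2, g, Cof, r, Λ₂'⟩`, `r = radiusOfRecord N F.L (2·L^m)` —
   file 5 v1.1 §6 + RR-1's `one_le_ne3NperOfRecord₁₁`), `s_N16_rRec₁₂_ofRecord_canonical_of_leafSlot` (for a reading pinned at the object of record with canonical
   letters: `LeafSlot` at one bundle per family ⇒ the stub — NO proviso left).
§3 (v1.1, APPEND-ONLY; generation 3) LETTERS TUNED INSIDE THE TOLERANCE: `radiusOfRecord_ofRecord_pos` ∕ `constOfRecord_ofRecord_nonneg` (THE END's thresholds AT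
   THE OBJECT OF RECORD), `inEndRegime_ofRecord_iff` (the proviso at RR-1's constant layer UNFOLDED for arbitrary letters `ℓ₀` — the side conditions `2 ≤ F.L`,
   `1 ≤ 2·L^m` discharged), `inEndRegime_ofRecord_of_letters` (letters `⟨r, b, g, C, r, Λ₂'⟩` with `0 ≤ b ≤ r∕2`, `Cof g ≤ C`: the regularity letter `b` and the
   constant `C` FREE inside THE END's tolerance), `s_N16_rRec₁₂_ofRecord_of_letters_of_leafSlot ∕ _of_printSlot` (§2's closer with `b F`, `C F` tuned).

HONEST FRAMING.  Kernel bookkeeping by name; `LeafSlot` ∕ `PrintSlot` stay HYPOTHESES (N05's leaf modulo its sockets; N07's [Balaban1985Variational] Thm 1 (8)+(10) TYPE);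
the constant layer is RR-1's typed pin convention (no claim about Bałaban's objects); no reading OF RECORD `𝔯` with this NE3 component is asserted to exist with the
other components pinned (W1 ∕ RR-2's business); no inhabitant of `IsDatumOfRecord₁₂C` claimed (K0′ open); **N16 ∕ NE3 NOT discharged**; count-neutral; one finite
four-torus at fixed ε — NOT ℝ⁴, NOT infinite volume, NOT OS, NOT a mass gap, NOT Clay.
-/

set_option autoImplicit false

open scoped BigOperators Matrix Matrix.Norms.L2Operator
open NormedSpace

namespace Summit.QuantumFields.YangMills.BalabanUVNodes.N16AtRRec12OfRecord

open Literature.MathematicalPhysics.QuantumFieldTheory.Balaban1983to89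
open Literature.MathematicalPhysics.QuantumFieldTheory.Balaban1983to89.T4Continuum (T4Family ULoop)
open Node00 (IsDatumOfRecord₁₂C Stage12Params NE3Objects₁₁ NE3Letters₁₁ ne3ConstLayerOfRecord₁₁ ne3NperOfRecord₁₁ ne3DomOfRecord₁₁ one_le_ne3NperOfRecord₁₁)
open Summit.QuantumFields.BalabanUV.T4Continuum
open YMDAG.UVSplit (Datum NE3Carriers RateCarriers RateRecordPred N16At S_N16 ne3OfRecord₁₁ RateReading₁₂ RRec₁₂)
open Summit.QuantumFields.YangMills.BalabanUVNodes.N16Regime (PrintSlot InEndRegime radiusOfRecord constOfRecord)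
open Summit.QuantumFields.YangMills.BalabanUVNodes.N16LeafSlot (LeafSlot)
open Summit.QuantumFields.YangMills.BalabanUVNodes.N16AtKeyedHome (inEndRegime_ne3OfRecord₁₁_canonical)
open Summit.QuantumFields.YangMills.BalabanUVNodes.N16AtRRec12ConstLayer (s_N16_rRec₁₂_iff_of_constLayer n16At_of_s_N16_rRec₁₂_constLayer
  s_N16_rRec₁₂_of_constLayer_printSlot s_N16_rRec₁₂_of_constLayer_leafSlot)

noncomputable section

variable {N : ℕ} [NeZero N] (𝔯 : RateReading₁₂ N) (ℓ : T4Family → NE3Letters₁₁)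

/-! ## §1 The stub at the NE3 object of record -/

/-- **FOR A READING PINNED AT THE NE3 OBJECT OF RECORD, `S_N16 (RRec₁₂ 𝔯)` IS ONE `N16At` PER FAMILY CARRYING A STAGE-12 DATUM OF RECORD** — at RR-1's constant
layer `ne3ConstLayerOfRecord₁₁ F N (ℓ F)` (period `2·L^m`, `dom` = all `2·L^m`-periodic `SU(N)` unit-lattice data).  `hpin` is `fun … => rfl` for a reading whose NE3
component is `Node00.ne3ConstReadingOfRecord₁₁ F N (ℓ F)`. [folklore] -/
theorem s_N16_rRec₁₂_iff_ofRecord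
    (hpin : ∀ (F : T4Family) (θ : Stage12Params F N) (hP : θ.Provisos₁₂ F N) (g₀ : ℕ → ℝ) (os : List (ULoop F)) (k : ℕ),
      (𝔯.lit F θ hP g₀ os).ne3 k = ne3ConstLayerOfRecord₁₁ F N (ℓ F)) :
    S_N16 (RRec₁₂ 𝔯) ↔ ∀ (F : T4Family), (∃ D : Datum F N, IsDatumOfRecord₁₂C F N D) → N16At (ne3OfRecord₁₁ F (ne3ConstLayerOfRecord₁₁ F N (ℓ F))) :=
  s_N16_rRec₁₂_iff_of_constLayer 𝔯 (fun F => ne3ConstLayerOfRecord₁₁ F N (ℓ F)) hpin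

/-- **n21-d's `h16` AT THE OBJECT OF RECORD**: under the stub, `N16At (ne3OfRecord₁₁ F (ne3ConstLayerOfRecord₁₁ F N (ℓ F)))` at every family carrying a Stage-12 datum of
record. [folklore] -/
theorem n16At_ofRecord_of_s_N16_rRec₁₂
    (hpin : ∀ (F : T4Family) (θ : Stage12Params F N) (hP : θ.Provisos₁₂ F N) (g₀ : ℕ → ℝ) (os : List (ULoop F)) (k : ℕ),
      (𝔯.lit F θ hP g₀ os).ne3 k = ne3ConstLayerOfRecord₁₁ F N (ℓ F))
    (hS : S_N16 (RRec₁₂ 𝔯)) (F : T4Family) {D : Datum F N} (hD : IsDatumOfRecord₁₂C F N D) :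
    N16At (ne3OfRecord₁₁ F (ne3ConstLayerOfRecord₁₁ F N (ℓ F))) :=
  n16At_of_s_N16_rRec₁₂_constLayer 𝔯 (fun F => ne3ConstLayerOfRecord₁₁ F N (ℓ F)) hpin hS F hD

/-- **THE KNIT AT THE OBJECT OF RECORD, PRINT FORM**: proviso + `PrintSlot` at the one bundle `ne3OfRecord₁₁ F (ne3ConstLayerOfRecord₁₁ F N (ℓ F))` of every family
carrying a Stage-12 datum of record ⇒ `S_N16 (RRec₁₂ 𝔯)`. [folklore] -/
theorem s_N16_rRec₁₂_ofRecord_of_printSlot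
    (hpin : ∀ (F : T4Family) (θ : Stage12Params F N) (hP : θ.Provisos₁₂ F N) (g₀ : ℕ → ℝ) (os : List (ULoop F)) (k : ℕ),
      (𝔯.lit F θ hP g₀ os).ne3 k = ne3ConstLayerOfRecord₁₁ F N (ℓ F))
    (h : ∀ (F : T4Family), (∃ D : Datum F N, IsDatumOfRecord₁₂C F N D) →
      InEndRegime (ne3OfRecord₁₁ F (ne3ConstLayerOfRecord₁₁ F N (ℓ F))) ∧ PrintSlot (ne3OfRecord₁₁ F (ne3ConstLayerOfRecord₁₁ F N (ℓ F)))) :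
    S_N16 (RRec₁₂ 𝔯) :=
  s_N16_rRec₁₂_of_constLayer_printSlot 𝔯 (fun F => ne3ConstLayerOfRecord₁₁ F N (ℓ F)) hpin h

/-- **THE KNIT AT THE OBJECT OF RECORD, LEAF FORM** (N05's typed leaf on the univ sub-family ∘ N07's `LeafH3sup`). [folklore] -/
theorem s_N16_rRec₁₂_ofRecord_of_leafSlot
    (hpin : ∀ (F : T4Family) (θ : Stage12Params F N) (hP : θ.Provisos₁₂ F N) (g₀ : ℕ → ℝ) (os : List (ULoop F)) (k : ℕ),
      (𝔯.lit F θ hP g₀ os).ne3 k = ne3ConstLayerOfRecord₁₁ F N (ℓ F))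
    (h : ∀ (F : T4Family), (∃ D : Datum F N, IsDatumOfRecord₁₂C F N D) →
      InEndRegime (ne3OfRecord₁₁ F (ne3ConstLayerOfRecord₁₁ F N (ℓ F))) ∧ LeafSlot (ne3OfRecord₁₁ F (ne3ConstLayerOfRecord₁₁ F N (ℓ F)))) :
    S_N16 (RRec₁₂ 𝔯) :=
  s_N16_rRec₁₂_of_constLayer_leafSlot 𝔯 (fun F => ne3ConstLayerOfRecord₁₁ F N (ℓ F)) hpin h

/-! ## §2 At THE END's canonical letters the proviso is automatic -/

/-- **THE PROVISO AT THE OBJECT OF RECORD WITH THE CANONICAL LETTERS** `⟨r, r∕2, g, Cof, r, Λ₂'⟩`, `r = radiusOfRecord N F.L (2·L^m)`,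
`Cof = constOfRecord N F.L (2·L^m) g`, any `g > 0`, `Λ₂'` (file 5 v1.1 §6 at RR-1's period and data; `1 ≤ 2·L^m` is RR-1's `one_le_ne3NperOfRecord₁₁`). [folklore] -/
theorem inEndRegime_ofRecord_canonical (F : T4Family) {g : ℝ} (hg : 0 < g) (Λ₂' : ℝ) :
    InEndRegime (ne3OfRecord₁₁ F (ne3ConstLayerOfRecord₁₁ F N
      ⟨radiusOfRecord N F.L (ne3NperOfRecord₁₁ F 0 0), radiusOfRecord N F.L (ne3NperOfRecord₁₁ F 0 0) / 2, g,
        constOfRecord N F.L (ne3NperOfRecord₁₁ F 0 0) g, radiusOfRecord N F.L (ne3NperOfRecord₁₁ F 0 0), Λ₂'⟩)) :=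
  inEndRegime_ne3OfRecord₁₁_canonical F (one_le_ne3NperOfRecord₁₁ F 0 0) hg Λ₂' (ne3DomOfRecord₁₁ F N 0 0)

/-- **THE KNIT AT THE OBJECT OF RECORD WITH CANONICAL LETTERS — `LeafSlot` ALONE**: for a reading pinned at RR-1's constant layer with THE END's canonical letters
(coupling letter `g F > 0`, any `Λ₂' F`), `LeafSlot` at the one bundle of every family carrying a Stage-12 datum of record gives `S_N16 (RRec₁₂ 𝔯)` — the proviso is
discharged by `inEndRegime_ofRecord_canonical`.  What N16 then owes at the record is the CONTENT of `LeafSlot` only. [folklore] -/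
theorem s_N16_rRec₁₂_ofRecord_canonical_of_leafSlot (g Λ₂' : T4Family → ℝ) (hg : ∀ F, 0 < g F)
    (hpin : ∀ (F : T4Family) (θ : Stage12Params F N) (hP : θ.Provisos₁₂ F N) (g₀ : ℕ → ℝ) (os : List (ULoop F)) (k : ℕ),
      (𝔯.lit F θ hP g₀ os).ne3 k = ne3ConstLayerOfRecord₁₁ F N
        ⟨radiusOfRecord N F.L (ne3NperOfRecord₁₁ F 0 0), radiusOfRecord N F.L (ne3NperOfRecord₁₁ F 0 0) / 2, g F,
          constOfRecord N F.L (ne3NperOfRecord₁₁ F 0 0) (g F), radiusOfRecord N F.L (ne3NperOfRecord₁₁ F 0 0), Λ₂' F⟩)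
    (hslot : ∀ (F : T4Family), (∃ D : Datum F N, IsDatumOfRecord₁₂C F N D) →
      LeafSlot (ne3OfRecord₁₁ F (ne3ConstLayerOfRecord₁₁ F N
        ⟨radiusOfRecord N F.L (ne3NperOfRecord₁₁ F 0 0), radiusOfRecord N F.L (ne3NperOfRecord₁₁ F 0 0) / 2, g F,
          constOfRecord N F.L (ne3NperOfRecord₁₁ F 0 0) (g F), radiusOfRecord N F.L (ne3NperOfRecord₁₁ F 0 0), Λ₂' F⟩))) :
    S_N16 (RRec₁₂ 𝔯) :=
  s_N16_rRec₁₂_of_constLayer_leafSlot 𝔯 _ hpin fun F hF => ⟨inEndRegime_ofRecord_canonical F (hg F) (Λ₂' F), hslot F hF⟩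

/-! ## §3 (v1.1, APPEND-ONLY) Letters TUNED INSIDE THE TOLERANCE — the proviso at the object of record for arbitrary letters; the knit with `b`, `C` free

WHY (dag-n21-d g3 INTENT-2, pub-ymgap INBOX l.14093).  THE END's regime at a bundle asks `0 < ε ≤ r`, `0 ≤ Λ₁ ≤ r`, `0 ≤ b ≤ ε∕2`, `Cof g ≤ C` (`N16Regime.inEndRegime_iff`);
§2 chose the extreme letters `b = r∕2`, `C = Cof`.  A consumer with its own numeral on `b` (N21: `512·5·8·L²·b ≤ 1`) or on `C` picks other letters INSIDE the tolerance;
the theorems below serve every such choice at once.  No letter is DEFINED here (N21's `b⋆` lives in N21's file). -/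

open Summit.QuantumFields.YangMills.BalabanUVNodes.N16Regime (radiusOfRecord_pos constOfRecord_nonneg)
open Summit.QuantumFields.YangMills.BalabanUVNodes.N16AtRateRecord11 (inEndRegime_ne3Objects_iff)

/-- **THE END's RADIUS AT THE OBJECT OF RECORD IS POSITIVE**: `0 < radiusOfRecord N F.L (ne3NperOfRecord₁₁ F 0 0)` (file 1's `radiusOfRecord_pos` at the family's
`2 ≤ F.L` — `HistoryFlow.two_le_L` — and RR-1's `one_le_ne3NperOfRecord₁₁`). [folklore] -/
theorem radiusOfRecord_ofRecord_pos (F : T4Family) : 0 < radiusOfRecord N F.L (ne3NperOfRecord₁₁ F 0 0) :=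
  radiusOfRecord_pos (HistoryFlow.two_le_L F) (one_le_ne3NperOfRecord₁₁ F 0 0)

/-- **THE END's CONSTANT AT THE OBJECT OF RECORD IS NON-NEGATIVE** for a positive coupling letter: `0 ≤ constOfRecord N F.L (ne3NperOfRecord₁₁ F 0 0) g`. [folklore] -/
theorem constOfRecord_ofRecord_nonneg (F : T4Family) {g : ℝ} (hg : 0 < g) : 0 ≤ constOfRecord N F.L (ne3NperOfRecord₁₁ F 0 0) g :=
  constOfRecord_nonneg (HistoryFlow.two_le_L F) (one_le_ne3NperOfRecord₁₁ F 0 0) hg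

/-- **THE PROVISO AT THE OBJECT OF RECORD, UNFOLDED FOR ARBITRARY LETTERS `ℓ₀`**: at RR-1's constant layer `ne3ConstLayerOfRecord₁₁ F N ℓ₀` THE END's regime is the
eight letter lines `0 < g`, `0 < ε ≤ r`, `0 ≤ Λ₁ ≤ r`, `0 ≤ b ≤ ε∕2`, `Cof g ≤ C` with `r = radiusOfRecord N F.L (ne3NperOfRecord₁₁ F 0 0)`,
`Cof g = constOfRecord N F.L (ne3NperOfRecord₁₁ F 0 0) g` — the block-factor and period side conditions (`2 ≤ F.L`, `1 ≤ 2·L^m`) are the family's and RR-1's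
(file 3's `inEndRegime_ne3Objects_iff` + `one_le_ne3NperOfRecord₁₁`). [folklore] -/
theorem inEndRegime_ofRecord_iff (F : T4Family) (ℓ₀ : NE3Letters₁₁) :
    InEndRegime (ne3OfRecord₁₁ F (ne3ConstLayerOfRecord₁₁ F N ℓ₀)) ↔
      0 < ℓ₀.g ∧ 0 < ℓ₀.ε ∧ ℓ₀.ε ≤ radiusOfRecord N F.L (ne3NperOfRecord₁₁ F 0 0) ∧ 0 ≤ ℓ₀.Λ₁ ∧ ℓ₀.Λ₁ ≤ radiusOfRecord N F.L (ne3NperOfRecord₁₁ F 0 0) ∧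
        0 ≤ ℓ₀.b ∧ ℓ₀.b ≤ ℓ₀.ε / 2 ∧ constOfRecord N F.L (ne3NperOfRecord₁₁ F 0 0) ℓ₀.g ≤ ℓ₀.C := by
  refine (inEndRegime_ne3Objects_iff F (ne3ConstLayerOfRecord₁₁ F N ℓ₀)).trans ?_
  exact ⟨fun h => h.2, fun h => ⟨one_le_ne3NperOfRecord₁₁ F 0 0, h⟩⟩

/-- **THE PROVISO AT THE OBJECT OF RECORD WITH `b`, `C` TUNED INSIDE THE TOLERANCE**: letters `⟨r, b, g, C, r, Λ₂'⟩` with `r = radiusOfRecord N F.L (ne3NperOfRecord₁₁ F 0 0)`,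
any `g > 0`, any regularity letter `0 ≤ b ≤ r∕2`, any constant `C ≥ constOfRecord N F.L (ne3NperOfRecord₁₁ F 0 0) g`, any `Λ₂'`, lie in THE END's regime.  §2's
`inEndRegime_ofRecord_canonical` is the instance `b = r∕2`, `C = Cof g`; N21's tuned `b⋆ = min (r∕2) (1∕(512·5·8·L²))` is another. [folklore] -/
theorem inEndRegime_ofRecord_of_letters (F : T4Family) {g b C : ℝ} (hg : 0 < g) (hb₀ : 0 ≤ b)
    (hb : b ≤ radiusOfRecord N F.L (ne3NperOfRecord₁₁ F 0 0) / 2) (hC : constOfRecord N F.L (ne3NperOfRecord₁₁ F 0 0) g ≤ C) (Λ₂' : ℝ) :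
    InEndRegime (ne3OfRecord₁₁ F (ne3ConstLayerOfRecord₁₁ F N
      ⟨radiusOfRecord N F.L (ne3NperOfRecord₁₁ F 0 0), b, g, C, radiusOfRecord N F.L (ne3NperOfRecord₁₁ F 0 0), Λ₂'⟩)) :=
  have hr : 0 < radiusOfRecord N F.L (ne3NperOfRecord₁₁ F 0 0) := radiusOfRecord_ofRecord_pos F
  (inEndRegime_ofRecord_iff F _).2 ⟨hg, hr, le_rfl, hr.le, le_rfl, hb₀, hb, hC⟩

/-- **THE KNIT AT THE OBJECT OF RECORD WITH TUNED LETTERS — `LeafSlot` ALONE**: for a reading pinned at RR-1's constant layer with letters `⟨r, b F, g F, C F, r, Λ₂' F⟩`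
inside THE END's tolerance (`0 < g F`, `0 ≤ b F ≤ r∕2`, `Cof (g F) ≤ C F`), `LeafSlot` at the one bundle of every family carrying a Stage-12 datum of record gives
`S_N16 (RRec₁₂ 𝔯)` — §1's leaf-form knit with the proviso discharged by `inEndRegime_ofRecord_of_letters`. [folklore] -/
theorem s_N16_rRec₁₂_ofRecord_of_letters_of_leafSlot (g b C Λ₂' : T4Family → ℝ) (hg : ∀ F, 0 < g F) (hb₀ : ∀ F, 0 ≤ b F)
    (hb : ∀ F : T4Family, b F ≤ radiusOfRecord N F.L (ne3NperOfRecord₁₁ F 0 0) / 2)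
    (hC : ∀ F : T4Family, constOfRecord N F.L (ne3NperOfRecord₁₁ F 0 0) (g F) ≤ C F)
    (hpin : ∀ (F : T4Family) (θ : Stage12Params F N) (hP : θ.Provisos₁₂ F N) (g₀ : ℕ → ℝ) (os : List (ULoop F)) (k : ℕ),
      (𝔯.lit F θ hP g₀ os).ne3 k = ne3ConstLayerOfRecord₁₁ F N
        ⟨radiusOfRecord N F.L (ne3NperOfRecord₁₁ F 0 0), b F, g F, C F, radiusOfRecord N F.L (ne3NperOfRecord₁₁ F 0 0), Λ₂' F⟩)
    (hslot : ∀ (F : T4Family), (∃ D : Datum F N, IsDatumOfRecord₁₂C F N D) →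
      LeafSlot (ne3OfRecord₁₁ F (ne3ConstLayerOfRecord₁₁ F N
        ⟨radiusOfRecord N F.L (ne3NperOfRecord₁₁ F 0 0), b F, g F, C F, radiusOfRecord N F.L (ne3NperOfRecord₁₁ F 0 0), Λ₂' F⟩))) :
    S_N16 (RRec₁₂ 𝔯) :=
  s_N16_rRec₁₂_of_constLayer_leafSlot 𝔯 _ hpin fun F hF =>
    ⟨inEndRegime_ofRecord_of_letters F (hg F) (hb₀ F) (hb F) (hC F) (Λ₂' F), hslot F hF⟩

/-- **THE KNIT AT THE OBJECT OF RECORD WITH TUNED LETTERS — PRINT FORM** (`PrintSlot` in place of `LeafSlot`). [folklore] -/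
theorem s_N16_rRec₁₂_ofRecord_of_letters_of_printSlot (g b C Λ₂' : T4Family → ℝ) (hg : ∀ F, 0 < g F) (hb₀ : ∀ F, 0 ≤ b F)
    (hb : ∀ F : T4Family, b F ≤ radiusOfRecord N F.L (ne3NperOfRecord₁₁ F 0 0) / 2)
    (hC : ∀ F : T4Family, constOfRecord N F.L (ne3NperOfRecord₁₁ F 0 0) (g F) ≤ C F)
    (hpin : ∀ (F : T4Family) (θ : Stage12Params F N) (hP : θ.Provisos₁₂ F N) (g₀ : ℕ → ℝ) (os : List (ULoop F)) (k : ℕ),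
      (𝔯.lit F θ hP g₀ os).ne3 k = ne3ConstLayerOfRecord₁₁ F N
        ⟨radiusOfRecord N F.L (ne3NperOfRecord₁₁ F 0 0), b F, g F, C F, radiusOfRecord N F.L (ne3NperOfRecord₁₁ F 0 0), Λ₂' F⟩)
    (hslot : ∀ (F : T4Family), (∃ D : Datum F N, IsDatumOfRecord₁₂C F N D) →
      PrintSlot (ne3OfRecord₁₁ F (ne3ConstLayerOfRecord₁₁ F N
        ⟨radiusOfRecord N F.L (ne3NperOfRecord₁₁ F 0 0), b F, g F, C F, radiusOfRecord N F.L (ne3NperOfRecord₁₁ F 0 0), Λ₂' F⟩))) :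
    S_N16 (RRec₁₂ 𝔯) :=
  s_N16_rRec₁₂_of_constLayer_printSlot 𝔯 _ hpin fun F hF =>
    ⟨inEndRegime_ofRecord_of_letters F (hg F) (hb₀ F) (hb F) (hC F) (Λ₂' F), hslot F hF⟩

end

end Summit.QuantumFields.YangMills.BalabanUVNodes.N16AtRRec12OfRecord
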